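import Mathlib
import Literature.NumberTheory.LFunctions.Zhang2022.TypedSection17
import Literature.NumberTheory.LFunctions.Zhang2022.Section17MeanSquareMajorant
import Literature.NumberTheory.LFunctions.Zhang2022.Section3Lemma34
import HarnessLib

/-!
# Zhang (2022) §17 p. 98: the coefficients `ν₁*` below `D⁴` — `ν₁*(m) = (μχ ∗ 1)(m) + O(δ·τ₄(m))` —
# and the Euler-product counts of the two majorants `|ν|·(τ₂ ∗ |μχ∗1|)`, `|ν|·τ₆`

Topic `Literature/NumberTheory/LFunctions/Zhang2022` (Landau–Siegel audit tree; verdict-neutral).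
Y. Zhang, *Discrete mean estimates and the Landau–Siegel zero*, arXiv:2211.02515v1 (2022)
[Zhang2022LandauSiegel] — **an unrefereed manuscript under adjudication**; nothing here asserts or
denies its Theorems 1–2. §17 pp. 97–98 (tex L4793, L4825–L4837; DAG `Z22:§17.u014`, `Z22:§17.u024`):
`ν₁*` is the `ψ`-coefficient sequence of `G(s,ψ)N(s+β₂,ψ)N(s+β₃,ψ)` (§17.u014; typed
`Typed.Section17.nuOneStar c′ χ = υ·[≤D⁴] ∗ nN_{β₂} ∗ nN_{β₃}`, `υ = μ ∗ μχ`, `nN_β(n) = n^{−β}g*(T²/n)`).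
The step u021 + u023 ⇒ u024 of p. 98 sums the error of u023 against the weights
`(|ν(l)|/l)·Σ_{l=l₁l₂} τ₂(l₁)|ν₁*(l₂)|`, `l < D⁴` (hypothesis `hE` of the tree's kernel edge
`Phi3Eval.step17_u024_of`, GAP row G-d58-1 of the cell siegel-zhang). This file supplies the
elementary inputs of that summation (the summation itself is `Section17SummedError`):

* `sum_sum_ups_eq` — THE CANCELLATION: `υ ∗ 1 ∗ 1 = μχ ∗ 1` (`μ ∗ 1 = δ`), i.e.
  `Σ_{m=ar}Σ_{a=a₁a₂} υ(a₁) = Σ_{d∣m} μ(d)χ(d) = ∏_{p∣m}(1 − χ(p))`, which VANISHES at the primes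
  with `χ(p) = 1` — exactly where `ν(p) = 1 + χ(p)` does not;
* `norm_nuOneStar_le` — for `m ≤ D⁴` (the truncation `[≤ D⁴]` is invisible there): if
  `|nN_{β_j}(n) − 1| ≤ δ ≤ 1` for `1 ≤ n ≤ D⁴` then `|ν₁*(m)| ≤ |Σ_{d∣m} μ(d)χ(d)| + 3δ·τ₄(m)`
  (expand `(1+η₂)(1+η₃)`; `|υ| ≤ τ₂` is (3.1), the tree's `Lemma34.norm_ups_le`);
* the majorant BLOCKS (`MeanSquareMajorant.IsBlock`, `Section17MeanSquareMajorant`): `isBlock_pmul`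
  (pointwise products), `isBlock_normAF_nu` (`|ν|`, degree 2), `isBlock_normAF_moebiusChi_mul_zeta`
  (`|μχ∗1|`, degree 1), their prime values `|1+χ(p)|`, `|1−χ(p)|`, and the prime count
  `|1+χ(p)|(2+|1−χ(p)|) ≤ 4` for a real `χ`;
* `sum_F1_div_le`, `sum_F2_div_le` — Hall–Tenenbaum + Mertens (the tree's
  `MeanSquareMajorant.sum_div_le`): `Σ_{n≤X} F₁(n)/n ≤ M₁(log X)⁴` for `F₁ = |ν|·(τ₂ ∗ |μχ∗1|)` and
  `Σ_{n≤X} F₂(n)/n ≤ M₂(log X)¹²` for `F₂ = |ν|·τ₆` (`M_i = majorantConst …`).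

Theorems only (no definitions, no named facts); axioms standard. WHAT THIS IS NOT: any claim about
the displays of §17, about Theorems 1–2 of the source or about Landau–Siegel zeros; nothing here
bears on the cell's verdict on (8.24).

## References

* Y. Zhang, arXiv:2211.02515v1 (2022), §17 pp. 97–98 (u014, u021–u024); §3 p. 6 (`ν`, `υ`, (3.1));
  §6 Lemma 6.1 (`N(s,ψ)`). [cite: Zhang2022LandauSiegel, §17 p.98]
* R. R. Hall, G. Tenenbaum, *Divisors*, CUP 1988, (0.4). [cite: HallTenenbaum1988, (0.4)]
-/

noncomputable section

open Complex Real Finset ArithmeticFunction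
open Literature.NumberTheory.LFunctions.Zhang2022.Skeleton
open Literature.NumberTheory.LFunctions.Zhang2022.Typed.Section17
open Literature.NumberTheory.LFunctions.Zhang2022.MeanSquareMajorant

namespace Literature.NumberTheory.LFunctions.Zhang2022.Phi3Eval

/-! ## §1. Majorant blocks: pointwise products, `|ν|`, `|μχ ∗ 1|` -/

/-- Pointwise products of blocks are blocks (degrees add) — the majorant algebra of the
Hall–Tenenbaum Euler-product bound. [cite: HallTenenbaum1988, (0.4)] -/
theorem isBlock_pmul {g₁ g₂ : ArithmeticFunction ℝ} {c₁ c₂ : ℕ} (h₁ : IsBlock g₁ c₁)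
    (h₂ : IsBlock g₂ c₂) : IsBlock (g₁.pmul g₂) (c₁ + c₂) :=
  ⟨h₁.isMult.pmul h₂.isMult, fun n => by rw [pmul_apply]; exact mul_nonneg (h₁.nonneg _) (h₂.nonneg _),
    fun p i hp => by
      rw [pmul_apply, pow_add]
      exact mul_le_mul (h₁.pow_le p i hp) (h₂.pow_le p i hp) (h₂.nonneg _) (by positivity)⟩

section Blocks

variable {D : ℕ} (χ : DirichletCharacter ℂ D)

/-- The arithmetic function of `χ` is multiplicative (Mathlib). [cite: Zhang2022LandauSiegel, §3 p.6] -/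
theorem isMultiplicative_chiAF :
    (toArithmeticFunction (fun n : ℕ => χ (n : ZMod D))).IsMultiplicative :=
  DirichletCharacter.isMultiplicative_toArithmeticFunction χ

/-- `ν = ζ ∗ χ` as an arithmetic function evaluates to the tree's `Skeleton.nu χ`.
[cite: Zhang2022LandauSiegel, §3 p.6] -/
theorem nuAF_apply (n : ℕ) :
    ((ArithmeticFunction.zeta : ArithmeticFunction ℂ) *
      toArithmeticFunction (fun n : ℕ => χ (n : ZMod D))) n = nu χ n := by
  rw [show nu χ n = Literature.NumberTheory.LFunctions.divisorSumChar χ n from rfl,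
    Literature.NumberTheory.LFunctions.divisorSumChar_eq_zeta_mul]

/-- `|ν|` is a block of degree `2` (`|ν(p^i)| ≤ τ₂(p^i) ≤ (i+1)²`). [cite: Zhang2022LandauSiegel, §3 p.6] -/
theorem isBlock_normAF_nu :
    IsBlock (normAF ((ArithmeticFunction.zeta : ArithmeticFunction ℂ) *
      toArithmeticFunction (fun n : ℕ => χ (n : ZMod D)))) 2 := by
  refine ⟨isMultiplicative_normAF (isMultiplicative_zeta.natCast.mul (isMultiplicative_chiAF χ)),
    fun n => by rw [normAF_apply]; exact norm_nonneg _, fun p i hp => ?_⟩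
  rw [normAF_apply, nuAF_apply]
  calc ‖nu χ (p ^ i)‖ ≤ ((p ^ i).divisors.card : ℝ) :=
        Literature.NumberTheory.LFunctions.norm_divisorSumChar_le χ _
    _ = tau 2 (p ^ i) := (tau_two_apply _).symm
    _ ≤ ((i : ℝ) + 1) ^ 2 := tau_prime_pow_le 2 hp i

/-- `|μχ ∗ 1|` is a block of degree `1` (`|Σ_{d∣p^i} μ(d)χ(d)| ≤ i + 1`).
[cite: Zhang2022LandauSiegel, §3 p.6] -/
theorem isBlock_normAF_moebiusChi_mul_zeta :
    IsBlock (normAF (((ArithmeticFunction.moebius : ArithmeticFunction ℂ).pmul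
      (toArithmeticFunction (fun n : ℕ => χ (n : ZMod D)))) *
        (ArithmeticFunction.zeta : ArithmeticFunction ℂ))) 1 := by
  refine ⟨isMultiplicative_normAF
      ((ArithmeticFunction.isMultiplicative_moebius.intCast.pmul (isMultiplicative_chiAF χ)).mul
        isMultiplicative_zeta.natCast),
    fun n => by rw [normAF_apply]; exact norm_nonneg _, fun p i hp => ?_⟩
  rw [normAF_apply, coe_mul_zeta_apply, pow_one]
  calc ‖∑ d ∈ (p ^ i).divisors, ((ArithmeticFunction.moebius : ArithmeticFunction ℂ).pmul
          (toArithmeticFunction (fun n : ℕ => χ (n : ZMod D)))) d‖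
      ≤ ∑ d ∈ (p ^ i).divisors, ‖((ArithmeticFunction.moebius : ArithmeticFunction ℂ).pmul
          (toArithmeticFunction (fun n : ℕ => χ (n : ZMod D)))) d‖ := norm_sum_le _ _
    _ ≤ ∑ d ∈ (p ^ i).divisors, (1 : ℝ) := Finset.sum_le_sum fun d hd => by
        have hd0 : d ≠ 0 := (Nat.pos_of_mem_divisors hd).ne'
        rw [pmul_apply, intCoe_apply, norm_mul]
        have h1 : ‖((ArithmeticFunction.moebius d : ℤ) : ℂ)‖ ≤ 1 := by
          rw [Complex.norm_intCast]
          exact_mod_cast ArithmeticFunction.abs_moebius_le_one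
        have h2 : ‖toArithmeticFunction (fun n : ℕ => χ (n : ZMod D)) d‖ ≤ 1 := by
          simp only [toArithmeticFunction, ArithmeticFunction.coe_mk, hd0, if_false]
          exact χ.norm_le_one _
        calc _ ≤ 1 * 1 := mul_le_mul h1 h2 (norm_nonneg _) zero_le_one
          _ = 1 := one_mul _
    _ = (p ^ i).divisors.card := by simp
    _ = (i : ℝ) + 1 := by rw [Nat.divisors_prime_pow hp, Finset.card_map, Finset.card_range]; push_cast; ring

/-- At a prime: `|ν(p)| = |1 + χ(p)|`. [cite: Zhang2022LandauSiegel, §3 p.6] -/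
theorem normAF_nu_prime {p : ℕ} (hp : p.Prime) :
    normAF ((ArithmeticFunction.zeta : ArithmeticFunction ℂ) *
      toArithmeticFunction (fun n : ℕ => χ (n : ZMod D))) p = ‖1 + χ (p : ZMod D)‖ := by
  rw [normAF_apply, mul_apply_prime (by simp) (isMultiplicative_chiAF χ).map_one hp, natCoe_apply,
    zeta_apply_ne hp.ne_zero]
  simp [toArithmeticFunction, hp.ne_zero]

/-- At a prime: `|(μχ ∗ 1)(p)| = |1 − χ(p)|`. [cite: Zhang2022LandauSiegel, §3 p.6] -/
theorem normAF_moebiusChi_mul_zeta_prime {p : ℕ} (hp : p.Prime) :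
    normAF (((ArithmeticFunction.moebius : ArithmeticFunction ℂ).pmul
      (toArithmeticFunction (fun n : ℕ => χ (n : ZMod D)))) *
        (ArithmeticFunction.zeta : ArithmeticFunction ℂ)) p = ‖1 - χ (p : ZMod D)‖ := by
  rw [normAF_apply, mul_apply_prime ((ArithmeticFunction.isMultiplicative_moebius.intCast.pmul
      (isMultiplicative_chiAF χ)).map_one) (by simp) hp, natCoe_apply, zeta_apply_ne hp.ne_zero,
    pmul_apply, intCoe_apply, ArithmeticFunction.moebius_apply_prime hp]
  simp [toArithmeticFunction, hp.ne_zero]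
  rw [show -χ (p : ZMod D) + 1 = 1 - χ (p : ZMod D) by ring]

/-- The prime count of the main majorant: for a real (quadratic) `χ`,
`|1 + χ(p)|·(2 + |1 − χ(p)|) ≤ 4` (values `4, 3, 0` at `χ(p) = 1, 0, −1`).
[cite: Zhang2022LandauSiegel, §2 p.4] -/
theorem norm_one_add_mul_two_add_norm_one_sub_le (hχ : χ.IsQuadratic) (p : ℕ) :
    ‖1 + χ (p : ZMod D)‖ * (2 + ‖1 - χ (p : ZMod D)‖) ≤ 4 := by
  rcases hχ (p : ZMod D) with h | h | h <;> rw [h] <;> norm_num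

/-- `|1 + χ(p)| ≤ 2` for a quadratic `χ` (`ν(p) = 1 + χ(p) ≤ 2`, (3.1)). [cite: Zhang2022LandauSiegel, §3 (3.1)] -/
theorem norm_one_add_chi_le_two (hχ : χ.IsQuadratic) (p : ℕ) : ‖1 + χ (p : ZMod D)‖ ≤ 2 := by
  rcases hχ (p : ZMod D) with h | h | h <;> rw [h] <;> norm_num

/-- **The count for the main majorant `F₁ = |ν|·(τ₂ ∗ |μχ∗1|)`**: `Σ_{n≤X} F₁(n)/n ≤ M₁·(log X)⁴`
(`F₁(p) ≤ 4`, block of degree `6`; Hall–Tenenbaum + Mertens). [cite: HallTenenbaum1988, (0.4)] -/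
theorem sum_F1_div_le (hχ : χ.IsQuadratic) {X : ℕ} (hX : 2 ≤ X) :
    ∑ n ∈ Icc 1 X, ((normAF ((ArithmeticFunction.zeta : ArithmeticFunction ℂ) *
        toArithmeticFunction (fun n : ℕ => χ (n : ZMod D)))).pmul
      (tau 2 * normAF (((ArithmeticFunction.moebius : ArithmeticFunction ℂ).pmul
        (toArithmeticFunction (fun n : ℕ => χ (n : ZMod D)))) *
          (ArithmeticFunction.zeta : ArithmeticFunction ℂ)))) n / n ≤
      majorantConst 4 6 * Real.log X ^ 4 := by
  have hB := isBlock_pmul (isBlock_normAF_nu χ)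
    ((isBlock_tau 2).mul (isBlock_normAF_moebiusChi_mul_zeta χ))
  have h := sum_div_le (f := fun n => ((normAF ((ArithmeticFunction.zeta : ArithmeticFunction ℂ) *
        toArithmeticFunction (fun n : ℕ => χ (n : ZMod D)))).pmul
      (tau 2 * normAF (((ArithmeticFunction.moebius : ArithmeticFunction ℂ).pmul
        (toArithmeticFunction (fun n : ℕ => χ (n : ZMod D)))) *
          (ArithmeticFunction.zeta : ArithmeticFunction ℂ)))) n)
    (a := 4) (d := 6) (K := 0) hB.isMult.map_one (fun m n hmn => hB.isMult.map_mul_of_coprime hmn)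
    hB.nonneg le_rfl ?_ (fun p ν hp => hB.pow_le p ν hp) hX
  · simpa only [zero_mul, Real.exp_zero, mul_one] using h
  · intro p hp
    rw [pmul_apply, normAF_nu_prime χ hp,
      mul_apply_prime (tau_apply_one 2) (isBlock_normAF_moebiusChi_mul_zeta χ).isMult.map_one hp,
      tau_prime 2 hp, normAF_moebiusChi_mul_zeta_prime χ hp, zero_mul, add_zero]
    push_cast
    exact norm_one_add_mul_two_add_norm_one_sub_le χ hχ p

/-- **The count for the perturbation majorant `F₂ = |ν|·τ₆`**: `Σ_{n≤X} F₂(n)/n ≤ M₂·(log X)¹²`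
(`F₂(p) ≤ 12`, block of degree `8`). [cite: HallTenenbaum1988, (0.4)] -/
theorem sum_F2_div_le (hχ : χ.IsQuadratic) {X : ℕ} (hX : 2 ≤ X) :
    ∑ n ∈ Icc 1 X, ((normAF ((ArithmeticFunction.zeta : ArithmeticFunction ℂ) *
        toArithmeticFunction (fun n : ℕ => χ (n : ZMod D)))).pmul (tau 6)) n / n ≤
      majorantConst 12 8 * Real.log X ^ 12 := by
  have hB := isBlock_pmul (isBlock_normAF_nu χ) (isBlock_tau 6)
  have h := sum_div_le (f := fun n => ((normAF ((ArithmeticFunction.zeta : ArithmeticFunction ℂ) *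
        toArithmeticFunction (fun n : ℕ => χ (n : ZMod D)))).pmul (tau 6)) n)
    (a := 12) (d := 8) (K := 0) hB.isMult.map_one (fun m n hmn => hB.isMult.map_mul_of_coprime hmn)
    hB.nonneg le_rfl ?_ (fun p ν hp => hB.pow_le p ν hp) hX
  · simpa only [zero_mul, Real.exp_zero, mul_one] using h
  · intro p hp
    rw [pmul_apply, normAF_nu_prime χ hp, tau_prime 6 hp, zero_mul, add_zero]
    push_cast
    nlinarith [norm_one_add_chi_le_two χ hχ p, norm_nonneg (1 + χ (p : ZMod D))]

end Blocks

/-! ## §2. The coefficients `ν₁*` up to `D⁴`: `ν₁*(m) = (μχ ∗ 1)(m) + O(δ·τ₄(m))` -/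

section NuOne

variable (c' : ℝ) {D : ℕ} (χ : DirichletCharacter ℂ D)

/-- A member `(a, b)` of the divisor antidiagonal of `n` has `a ≠ 0`, `b ≠ 0`, `a ≤ n`, `b ≤ n`.
[folklore] -/
private theorem bounds_of_mem_divisorsAntidiagonal {n : ℕ} {x : ℕ × ℕ} (hx : x ∈ n.divisorsAntidiagonal) :
    x.1 ≠ 0 ∧ x.2 ≠ 0 ∧ x.1 ≤ n ∧ x.2 ≤ n := by
  have h := Nat.mem_divisorsAntidiagonal.1 hx
  have hn : 0 < n := Nat.pos_of_ne_zero h.2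
  have h1 : x.1 ≠ 0 := fun e => h.2 (by rw [← h.1, e, zero_mul])
  have h2 : x.2 ≠ 0 := fun e => h.2 (by rw [← h.1, e, mul_zero])
  exact ⟨h1, h2, Nat.le_of_dvd hn ⟨x.2, h.1.symm⟩, Nat.le_of_dvd hn ⟨x.1, by rw [mul_comm]; exact h.1.symm⟩⟩

/-- **The identity behind the cancellation**: `υ ∗ 1 ∗ 1 = μχ ∗ 1` (`υ = μ ∗ μχ`, `μ ∗ 1 = δ`), i.e.
`Σ_{m = a·r} Σ_{a = a₁a₂} υ(a₁) = Σ_{d ∣ m} μ(d)χ(d)`. [cite: Zhang2022LandauSiegel, §3 p.6] -/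
theorem sum_sum_ups_eq (m : ℕ) :
    ∑ x ∈ m.divisorsAntidiagonal, ∑ y ∈ x.1.divisorsAntidiagonal, ups χ y.1 =
      ∑ d ∈ m.divisors, (ArithmeticFunction.moebius d : ℂ) * χ (d : ZMod D) := by
  classical
  set X : ArithmeticFunction ℂ := toArithmeticFunction (fun n : ℕ => χ (n : ZMod D)) with hX
  set M : ArithmeticFunction ℂ := (ArithmeticFunction.moebius : ArithmeticFunction ℂ).pmul X with hM
  -- `υ`, as an arithmetic function, is `μ ∗ μχ`
  have hU : toArithmeticFunction (ups χ) = (ArithmeticFunction.moebius : ArithmeticFunction ℂ) * M := by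
    have h1 : toArithmeticFunction (fun n : ℕ => (ArithmeticFunction.moebius n : ℂ)) =
        (ArithmeticFunction.moebius : ArithmeticFunction ℂ) := by
      ext n
      by_cases hn : n = 0
      · subst hn; simp [toArithmeticFunction]
      · simp [toArithmeticFunction, hn]
    have h2 : toArithmeticFunction
        (fun n : ℕ => (ArithmeticFunction.moebius n : ℂ) * χ (n : ZMod D)) = M := by
      ext n
      by_cases hn : n = 0
      · subst hn; simp [toArithmeticFunction, hM]
      · simp [toArithmeticFunction, hn, hM, pmul_apply, hX]
    rw [Skeleton.ups, LSeries.convolution, ArithmeticFunction.toArithmeticFunction_eq_self, h1, h2]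
  -- `μ ∗ μχ ∗ ζ ∗ ζ = μχ ∗ ζ`
  have hζ : (ArithmeticFunction.moebius : ArithmeticFunction ℂ) * M *
      (ArithmeticFunction.zeta : ArithmeticFunction ℂ) * (ArithmeticFunction.zeta : ArithmeticFunction ℂ) =
      M * (ArithmeticFunction.zeta : ArithmeticFunction ℂ) := by
    calc (ArithmeticFunction.moebius : ArithmeticFunction ℂ) * M *
          (ArithmeticFunction.zeta : ArithmeticFunction ℂ) * (ArithmeticFunction.zeta : ArithmeticFunction ℂ)
        = ((ArithmeticFunction.moebius : ArithmeticFunction ℂ) *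
            (ArithmeticFunction.zeta : ArithmeticFunction ℂ)) *
          (M * (ArithmeticFunction.zeta : ArithmeticFunction ℂ)) := by ring
      _ = M * (ArithmeticFunction.zeta : ArithmeticFunction ℂ) := by
          rw [ArithmeticFunction.coe_moebius_mul_coe_zeta, one_mul]
  -- the left side is `(υ ∗ ζ ∗ ζ)(m)`
  have hL : ∑ x ∈ m.divisorsAntidiagonal, ∑ y ∈ x.1.divisorsAntidiagonal, ups χ y.1 =
      (toArithmeticFunction (ups χ) * (ArithmeticFunction.zeta : ArithmeticFunction ℂ) *
        (ArithmeticFunction.zeta : ArithmeticFunction ℂ)) m := by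
    rw [mul_apply]
    refine Finset.sum_congr rfl fun x hx => ?_
    obtain ⟨_, hx2, -, -⟩ := bounds_of_mem_divisorsAntidiagonal hx
    rw [natCoe_apply, zeta_apply_ne hx2, Nat.cast_one, mul_one, mul_apply]
    refine Finset.sum_congr rfl fun y hy => ?_
    obtain ⟨hy1, hy2, -, -⟩ := bounds_of_mem_divisorsAntidiagonal hy
    rw [natCoe_apply, zeta_apply_ne hy2, Nat.cast_one, mul_one]
    simp [toArithmeticFunction, hy1]
  rw [hL, hU, hζ, coe_mul_zeta_apply]
  refine Finset.sum_congr rfl fun d hd => ?_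
  have hd0 : d ≠ 0 := (Nat.pos_of_mem_divisors hd).ne'
  simp [hM, hX, pmul_apply, toArithmeticFunction, hd0]

/-- `Σ_{m = a·r} Σ_{a = a₁a₂} τ₂(a₁) = τ₄(m)` (`τ₂ ∗ 1 ∗ 1 = τ₄`). [folklore] -/
private theorem sum_sum_tau_two_eq (m : ℕ) :
    ∑ x ∈ m.divisorsAntidiagonal, ∑ y ∈ x.1.divisorsAntidiagonal, tau 2 y.1 = tau 4 m := by
  have h3 : ∀ k : ℕ, tau 3 k = ∑ y ∈ k.divisorsAntidiagonal, tau 2 y.1 := fun k => by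
    rw [show (3 : ℕ) = 2 + 1 from rfl, tau_add_apply]
    refine Finset.sum_congr rfl fun y hy => ?_
    obtain ⟨-, hy2, -, -⟩ := bounds_of_mem_divisorsAntidiagonal hy
    rw [tau_one_apply hy2, mul_one]
  rw [show (4 : ℕ) = 3 + 1 from rfl, tau_add_apply]
  refine Finset.sum_congr rfl fun x hx => ?_
  obtain ⟨-, hx2, -, -⟩ := bounds_of_mem_divisorsAntidiagonal hx
  rw [tau_one_apply hx2, mul_one, h3]

/-- **`ν₁*` up to `D⁴`.** If `|n^{−β_j}g*(T²/n) − 1| ≤ δ ≤ 1` for `1 ≤ n ≤ D⁴` (`j = 2, 3`), then for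
`m ≤ D⁴`, `|ν₁*(m)| ≤ |Σ_{d∣m} μ(d)χ(d)| + 3δ·τ₄(m)` (`ν₁* = υ·[≤D⁴] ∗ nN_{β₂} ∗ nN_{β₃}`, §17.u014;
the truncation is invisible below `D⁴`; expand `(1+η₂)(1+η₃)`, `|υ| ≤ τ₂` by (3.1)).
[cite: Zhang2022LandauSiegel, §17 p.97 (u014), p.98 (u024)] -/
theorem norm_nuOneStar_le {δ : ℝ} (hδ0 : 0 ≤ δ) (hδ1 : δ ≤ 1) {m : ℕ} (hmD : m ≤ D ^ 4)
    (hη : ∀ n : ℕ, n ≠ 0 → n ≤ D ^ 4 →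
      ‖nN D (beta2 c' D) n - 1‖ ≤ δ ∧ ‖nN D (beta3 c' D) n - 1‖ ≤ δ) :
    ‖nuOneStar c' χ m‖ ≤
      ‖∑ d ∈ m.divisors, (ArithmeticFunction.moebius d : ℂ) * χ (d : ZMod D)‖ + 3 * δ * tau 4 m := by
  classical
  -- expand `(1 + η₂)(1 + η₃)`
  have hexp : nuOneStar c' χ m =
      (∑ x ∈ m.divisorsAntidiagonal, ∑ y ∈ x.1.divisorsAntidiagonal, ups χ y.1) +
      ∑ x ∈ m.divisorsAntidiagonal, ∑ y ∈ x.1.divisorsAntidiagonal,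
        ups χ y.1 * ((nN D (beta2 c' D) y.2 - 1) + (nN D (beta3 c' D) x.2 - 1) +
          (nN D (beta2 c' D) y.2 - 1) * (nN D (beta3 c' D) x.2 - 1)) := by
    rw [← Finset.sum_add_distrib]
    simp only [nuOneStar, LSeries.convolution_def]
    refine Finset.sum_congr rfl fun x hx => ?_
    obtain ⟨-, -, hx1, -⟩ := bounds_of_mem_divisorsAntidiagonal hx
    rw [Finset.sum_mul, ← Finset.sum_add_distrib]
    refine Finset.sum_congr rfl fun y hy => ?_
    obtain ⟨-, -, hy1, -⟩ := bounds_of_mem_divisorsAntidiagonal hy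
    have htr : trunc (D ^ 4) (ups χ) y.1 = ups χ y.1 := by
      unfold trunc; exact if_pos (hy1.trans (hx1.trans hmD))
    rw [htr]
    ring
  rw [hexp, sum_sum_ups_eq]
  refine (norm_add_le _ _).trans (add_le_add le_rfl ?_)
  -- the perturbation terms
  calc ‖∑ x ∈ m.divisorsAntidiagonal, ∑ y ∈ x.1.divisorsAntidiagonal,
        ups χ y.1 * ((nN D (beta2 c' D) y.2 - 1) + (nN D (beta3 c' D) x.2 - 1) +
          (nN D (beta2 c' D) y.2 - 1) * (nN D (beta3 c' D) x.2 - 1))‖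
      ≤ ∑ x ∈ m.divisorsAntidiagonal, ∑ y ∈ x.1.divisorsAntidiagonal, tau 2 y.1 * (3 * δ) := by
        refine (norm_sum_le _ _).trans (Finset.sum_le_sum fun x hx => ?_)
        obtain ⟨-, hx2, hx1, hx2le⟩ := bounds_of_mem_divisorsAntidiagonal hx
        refine (norm_sum_le _ _).trans (Finset.sum_le_sum fun y hy => ?_)
        obtain ⟨-, hy2, -, hy2le⟩ := bounds_of_mem_divisorsAntidiagonal hy
        obtain ⟨h2, -⟩ := hη y.2 hy2 (hy2le.trans (hx1.trans hmD))
        obtain ⟨-, h3⟩ := hη x.2 hx2 (hx2le.trans hmD)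
        rw [norm_mul]
        refine mul_le_mul (Lemma34.norm_ups_le χ y.1) ?_ (norm_nonneg _) (tau_nonneg _ _)
        calc ‖(nN D (beta2 c' D) y.2 - 1) + (nN D (beta3 c' D) x.2 - 1) +
              (nN D (beta2 c' D) y.2 - 1) * (nN D (beta3 c' D) x.2 - 1)‖
            ≤ ‖nN D (beta2 c' D) y.2 - 1‖ + ‖nN D (beta3 c' D) x.2 - 1‖ +
                ‖nN D (beta2 c' D) y.2 - 1‖ * ‖nN D (beta3 c' D) x.2 - 1‖ := by
              refine (norm_add_le _ _).trans (add_le_add (norm_add_le _ _) ?_)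
              rw [norm_mul]
          _ ≤ δ + δ + δ * δ := by gcongr
          _ ≤ 3 * δ := by nlinarith
    _ = 3 * δ * tau 4 m := by
        rw [← sum_sum_tau_two_eq, Finset.mul_sum]
        refine Finset.sum_congr rfl fun x _ => ?_
        rw [Finset.mul_sum]
        exact Finset.sum_congr rfl fun y _ => by ring

end NuOne

end Literature.NumberTheory.LFunctions.Zhang2022.Phi3Eval
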